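import Mathlib.Combinatorics.SimpleGraph.Clique
import Summits.Ventures.DiscreteObjects.UnitDistance.UnitQuadranceF27IndepSet
import HarnessLib

/-!
# Characteristic 3: every edge of a unit-circle graph lies in a triangle; over `F₂₇` in exactly one (so `ω = 3`)

Framing (verbatim for the cell): lottery ticket; floor = certified bounds/negative ranges.

Two structural facts behind the census dossier of the open residue field `q = 27` (`UD(F₂₇²) = Cay(F₃⁶, 14 lines)`, TABLE-U5 §2 /
TABLE-U6 §1 of the cell), now in the kernel:

* `adj_triangle_of_char_three` — for ANY commutative ring `A` with `(3 : A) = 0`: if `x ~ y` in `unitCircleGraph A` then the third point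
  of the `F₃`-line through `x, y`, namely `z = x − (y − x) = 2x − y (= 2y − x)`, is adjacent to both (`|2s|² = 4|s|² = |s|²`).  So
  characteristic-3 unit-circle graphs are unions of triangles `{x, x + s, x − s}` — the feature separating `q = 3, 27, 243, …` from the
  prime fields of the atlas.
* `udF27_common_neighbour` — over the model `F27` the common neighbours of `0` and a circle point `s` are `{−s}` ONLY (`28 × 28` cases by
  `decide`), hence `adj_third_eq`: every edge of `unitCircleGraph F27` lies in EXACTLY one triangle, `no_K4` / `cliqueFree_four_F27`:
  there is no `K₄` (`ω(UD(F₂₇²)) = 3`; the clique bound gives only `α ≤ 243` — the certified `α ≤ 148` needs the SDP), transferred to every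
  field with 27 elements (`cliqueFree_four_of_card_eq_27`) along `FiniteField.ringEquivOfCardEq`.
-/

namespace Summit.Ventures.DiscreteObjects.UnitDistance

open SimpleGraph

/-! ## Characteristic 3: triangles through every edge -/

/-- In a commutative ring with `3 = 0`, `2 · a = 0` forces `a = 0` (`a = 4a = 2(2a)`). -/
theorem eq_zero_of_two_mul_eq_zero_of_char_three {A : Type*} [CommRing A] (h3 : (3 : A) = 0) {a : A} (h : 2 * a = 0) :
    a = 0 := by
  linear_combination (2 : A) * h - a * h3

/-- CHARACTERISTIC 3: if `x ~ y` in `unitCircleGraph A` and `(3 : A) = 0`, then `z := x − (y − x)` (the third point of the `F₃`-line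
through `x` and `y`) is adjacent to `x` and to `y`.  Every edge lies in a triangle. -/
theorem adj_triangle_of_char_three {A : Type*} [CommRing A] (h3 : (3 : A) = 0) {x y : A × A} (h : (unitCircleGraph A).Adj x y) :
    (unitCircleGraph A).Adj x (x - (y - x)) ∧ (unitCircleGraph A).Adj y (x - (y - x)) := by
  obtain ⟨hne, hq⟩ := h
  refine ⟨⟨?_, ?_⟩, ⟨?_, ?_⟩⟩
  · -- x ≠ x - (y - x): else y - x = 0
    intro hx
    apply hne
    have h1 : y.1 - x.1 = 0 := by
      have := congrArg Prod.fst hx; simp only [Prod.fst_sub] at this; linear_combination this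
    have h2 : y.2 - x.2 = 0 := by
      have := congrArg Prod.snd hx; simp only [Prod.snd_sub] at this; linear_combination this
    exact Prod.ext (by linear_combination (-1 : A) * h1) (by linear_combination (-1 : A) * h2)
  · simp only [Prod.fst_sub, Prod.snd_sub]
    linear_combination hq
  · -- y ≠ x - (y - x): else 2 (y - x) = 0, so y = x in characteristic 3
    intro hy
    apply hne
    have h1 : 2 * (y.1 - x.1) = 0 := by
      have := congrArg Prod.fst hy; simp only [Prod.fst_sub] at this; linear_combination this
    have h2 : 2 * (y.2 - x.2) = 0 := by
      have := congrArg Prod.snd hy; simp only [Prod.snd_sub] at this; linear_combination this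
    have e1 := eq_zero_of_two_mul_eq_zero_of_char_three h3 h1
    have e2 := eq_zero_of_two_mul_eq_zero_of_char_three h3 h2
    exact Prod.ext (by linear_combination (-1 : A) * e1) (by linear_combination (-1 : A) * e2)
  · simp only [Prod.fst_sub, Prod.snd_sub]
    linear_combination (4 : A) * hq + h3

/-! ## `F27`: exactly one triangle through every edge, no `K₄` -/

open F27

/-- KERNEL FACT: among the 28 circle points of `F27`, the only point at unit quadrance from a circle point `s` (and from `0`) is `−s`
(`28 × 28` raw quadrance evaluations): `N(0) ∩ N(s) = {−s}`. -/
theorem udF27_common_neighbour :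
    ∀ s ∈ udF27Circle, ∀ t ∈ udF27Circle, quadDiff s t = 1 → t = (F27.neg s.1, F27.neg s.2) := by
  decide +kernel

/-- Over `F27`, a common neighbour `z` of adjacent `x, y` is the third point `x − (y − x)` of their `F₃`-line: every edge lies in
EXACTLY one triangle. -/
theorem adj_third_eq {x y z : F27 × F27} (hxy : (unitCircleGraph F27).Adj x y) (hxz : (unitCircleGraph F27).Adj x z)
    (hyz : (unitCircleGraph F27).Adj y z) : z = x - (y - x) := by
  have hs : (y - x).1 ^ 2 + (y - x).2 ^ 2 = 1 := by
    have e1 : (y - x).1 ^ 2 = (x.1 - y.1) ^ 2 := by simp only [Prod.fst_sub]; ring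
    have e2 : (y - x).2 ^ 2 = (x.2 - y.2) ^ 2 := by simp only [Prod.snd_sub]; ring
    rw [e1, e2]; exact hxy.2
  have ht : (z - x).1 ^ 2 + (z - x).2 ^ 2 = 1 := by
    have e1 : (z - x).1 ^ 2 = (x.1 - z.1) ^ 2 := by simp only [Prod.fst_sub]; ring
    have e2 : (z - x).2 ^ 2 = (x.2 - z.2) ^ 2 := by simp only [Prod.snd_sub]; ring
    rw [e1, e2]; exact hxz.2
  have hst : quadDiff (y - x) (z - x) = 1 := by
    rw [quadDiff_eq]
    have e1 : ((y - x).1 - (z - x).1) ^ 2 = (y.1 - z.1) ^ 2 := by simp only [Prod.fst_sub]; ring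
    have e2 : ((y - x).2 - (z - x).2) ^ 2 = (y.2 - z.2) ^ 2 := by simp only [Prod.snd_sub]; ring
    rw [e1, e2]; exact hyz.2
  have key := udF27_common_neighbour (y - x) (mem_udF27Circle _ hs) (z - x) (mem_udF27Circle _ ht) hst
  have hneg : ((F27.neg (y - x).1, F27.neg (y - x).2) : F27 × F27) = -(y - x) := rfl
  rw [hneg] at key
  -- key : z - x = -(y - x)
  have hz : z = x + (z - x) := by abel
  rw [key] at hz
  rw [hz]; abel

/-- `unitCircleGraph F27` has no `K₄`: two adjacent vertices have exactly one common neighbour. -/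
theorem no_K4 {a b c d : F27 × F27} (hab : (unitCircleGraph F27).Adj a b) (hac : (unitCircleGraph F27).Adj a c)
    (hbc : (unitCircleGraph F27).Adj b c) (had : (unitCircleGraph F27).Adj a d) (hbd : (unitCircleGraph F27).Adj b d) :
    c = d := by
  rw [adj_third_eq hab hac hbc, adj_third_eq hab had hbd]

/-- `3 = 0` in `F27`. -/
theorem F27.three_eq_zero : (3 : F27) = 0 := by decide +kernel

/-- Every edge of `unitCircleGraph F27` lies in a triangle (the characteristic-3 lemma instantiated); with `adj_third_eq`, in exactly
one. -/
theorem adj_triangle_F27 {x y : F27 × F27} (h : (unitCircleGraph F27).Adj x y) :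
    (unitCircleGraph F27).Adj x (x - (y - x)) ∧ (unitCircleGraph F27).Adj y (x - (y - x)) :=
  adj_triangle_of_char_three F27.three_eq_zero h

/-- `unitCircleGraph F27` is `K₄`-free in Mathlib's sense (`ω = 3`). -/
theorem cliqueFree_four_F27 : (unitCircleGraph F27).CliqueFree 4 := by
  classical
  intro t ht
  have hcl := ht.isClique
  obtain ⟨a, t3, hat3, rfl, ht3⟩ := Finset.card_eq_succ.1 ht.card_eq
  obtain ⟨b, c, d, hbc, hbd, hcd, rfl⟩ := Finset.card_eq_three.1 ht3
  simp only [Finset.mem_insert, Finset.mem_singleton, not_or] at hat3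
  obtain ⟨hab, hac, had⟩ := hat3
  have ma : a ∈ insert a ({b, c, d} : Finset (F27 × F27)) := Finset.mem_insert_self _ _
  have mb : b ∈ insert a ({b, c, d} : Finset (F27 × F27)) := by simp
  have mc : c ∈ insert a ({b, c, d} : Finset (F27 × F27)) := by simp
  have md : d ∈ insert a ({b, c, d} : Finset (F27 × F27)) := by simp
  exact hcd (no_K4 (hcl ma mb hab) (hcl ma mc hac) (hcl mb mc hbc) (hcl ma md had) (hcl mb md hbd))

/-- Adjacency is preserved and reflected by the map induced by a ring isomorphism. -/
theorem unitCircleGraph_adj_ringEquiv {K L : Type*} [Field K] [Field L] (e : K ≃+* L) (x y : K × K) :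
    (unitCircleGraph L).Adj (e x.1, e x.2) (e y.1, e y.2) ↔ (unitCircleGraph K).Adj x y := by
  constructor
  · rintro ⟨hne, hq⟩
    refine ⟨fun h => hne (by rw [h]), ?_⟩
    have := congrArg e.symm hq
    simpa [map_add, map_pow, map_sub] using this
  · rintro ⟨hne, hq⟩
    refine ⟨fun h => hne ?_, ?_⟩
    · have h1 := congrArg Prod.fst h
      have h2 := congrArg Prod.snd h
      simp only [e.injective.eq_iff] at h1 h2
      exact Prod.ext h1 h2
    · have := congrArg e hq
      simpa [map_add, map_pow, map_sub] using this

/-- TRANSFER: for every field `F` with 27 elements, `unitCircleGraph F` is `K₄`-free (and, by `adj_triangle_of_char_three`, every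
edge lies in a triangle): `ω(unitCircleGraph F) = 3`. -/
theorem cliqueFree_four_of_card_eq_27 (F : Type*) [Field F] [Fintype F] (hF : Fintype.card F = 27) :
    (unitCircleGraph F).CliqueFree 4 := by
  classical
  have e : F ≃+* F27 := FiniteField.ringEquivOfCardEq (by rw [hF, F27.card_eq])
  intro t ht
  let φ : F × F ↪ F27 × F27 := ⟨fun x => (e x.1, e x.2), fun x y h => by
    have h1 := congrArg Prod.fst h
    have h2 := congrArg Prod.snd h
    simp only [e.injective.eq_iff] at h1 h2
    exact Prod.ext h1 h2⟩
  have hcl : (unitCircleGraph F27).IsNClique 4 (t.map φ) := by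
    refine ⟨?_, by rw [Finset.card_map, ht.card_eq]⟩
    intro a ha b hb hab
    rw [Finset.coe_map] at ha hb
    obtain ⟨x, hx, rfl⟩ := ha
    obtain ⟨y, hy, rfl⟩ := hb
    have hxy : x ≠ y := by rintro rfl; exact hab rfl
    exact (unitCircleGraph_adj_ringEquiv e x y).2 (ht.isClique hx hy hxy)
  exact cliqueFree_four_F27 _ hcl

end Summit.Ventures.DiscreteObjects.UnitDistance
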